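import Literature.Algebra.Homology.TraceHomologyShortComplex
import HarnessLib

/-!
# The Hopf trace formula for Mathlib's `HomologicalComplex`: `Σ χ(i) tr(φ|Cⁱ) = Σ χ(i) tr(H(φ)|Hⁱ)` (LEAF 2)

Layer `Literature/Algebra/Homology` (pure linear algebra over Mathlib; proved theorems only, 0 definitions, 0 named facts, no
instances, no notation). For an endomorphism `φ : C ⟶ C` of a homological complex of finite-dimensional vector spaces over a
field `K`, of ANY shape `c` with `ComplexShape.EulerCharSigns`, with finitely many non-zero terms (Hatcher Thm. 2C.3:
"`Σ (−1)ⁿ tr(f♯ : Cₙ → Cₙ) = Σ (−1)ⁿ tr(f_* : Hₙ → Hₙ)`"; Spanier 4.7.6):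

* `trace_f_eq` — degreewise, from LEAF 1 (`HopfTrace.trace_τ₂_eq` on `C.sc i`):
  `tr(φᵢ) = tr(H(φ)ᵢ) + tr(φ_{next i} | im d(i, next i)) + tr(φᵢ | im d(prev i, i))`;
* `finsum_χ_smul_eq_neg_of_pairing` — the additive-group-valued twin of row `EulerCharacteristicShortExact`'s pairing lemma
  (`b j = 0` without predecessor, `a i = 0` without successor, `b j = a i` across `c.Rel i j` ⇒ `Σᶠ χ(j)•b j = −Σᶠ χ(i)•a i`);
* **`finsum_χ_smul_trace_eq : Σᶠ i, χ(i) • tr(φ.f i) = Σᶠ i, χ(i) • tr(homologyMap φ i)`** (the boundary traces cancel in pairs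
  `i ↔ next i`), its `Finset` form `sum_χ_smul_trace_eq` and the `ℤ`-`Icc` cochain form `CochainComplex.sum_negOnePow_smul_trace_eq`.

With `φ = 𝟙` (`LinearMap.trace_id`: `tr 𝟙 = dim`) this is the Euler–Poincaré formula of row `EulerPoincareFormula`, not restated here.
NOT this statement: `Combinatorics/SimpleGraph/GraphAutomorphismsOneForms` (the two-term graph case `#Fix − e₊ + e₋ = 1 − tr(α^*|𝓗¹)`)
and `Analysis/InnerProduct/HilbertComplexLefschetzSupertrace` (eigenvalue-level supertrace cancellation for Hilbert complexes).
Library only (cell `pub-hodge-ring2`, count-neutral); proves nothing about any crux, route or conjecture.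

## References

* A. Hatcher, *Algebraic Topology* (2002), §2.C, Thm. 2C.3 (Hopf trace formula). [HatcherAT2002]
* E. H. Spanier, *Algebraic Topology* (1981), Ch. 4 §7, Thm. 6. [Spanier1981]
-/

open CategoryTheory CategoryTheory.Limits

universe v u w

namespace Literature.Algebra.Homology.HopfTrace

variable {K : Type u} [Field K] {ι : Type w} {c : ComplexShape ι}

/-! ### The pairing lemma with values in an additive group -/

/-- **Pairing lemma, additive-group values**: if `b j = 0` whenever `j` has no predecessor, `a i = 0` whenever `i` has no successor
and `b j = a i` across every `c.Rel i j`, then `Σᶠ j, χ(j) • b j = −Σᶠ i, χ(i) • a i`. [cite: HatcherAT2002, Thm. 2C.3 (proof)] -/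
theorem finsum_χ_smul_eq_neg_of_pairing [c.EulerCharSigns] {M : Type*} [AddCommGroup M] (a b : ι → M)
    (hb : ∀ j, ¬c.Rel (c.prev j) j → b j = 0) (ha : ∀ i, ¬c.Rel i (c.next i) → a i = 0)
    (hab : ∀ i j, c.Rel i j → b j = a i) :
    ∑ᶠ j, (c.χ j : ℤ) • b j = -∑ᶠ i, (c.χ i : ℤ) • a i := by
  set S : Set ι := {j | c.Rel (c.prev j) j} with hS
  set T : Set ι := {i | c.Rel i (c.next i)} with hT
  have hbij : Set.BijOn c.prev S T := by
    refine ⟨fun j hj => ?_, fun j hj j' hj' h => ?_, fun i hi => ?_⟩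
    · show c.Rel (c.prev j) (c.next (c.prev j))
      rwa [c.next_eq' hj]
    · have h1 := c.next_eq' (show c.Rel (c.prev j) j from hj)
      have h2 := c.next_eq' (show c.Rel (c.prev j') j' from hj')
      rw [← h1, ← h2, h]
    · refine ⟨c.next i, ?_, c.prev_eq' hi⟩
      show c.Rel (c.prev (c.next i)) (c.next i)
      rwa [c.prev_eq' hi]
  have lhs : ∑ᶠ j, (c.χ j : ℤ) • b j = ∑ᶠ j ∈ S, (c.χ j : ℤ) • b j := by
    rw [finsum_mem_def, Set.indicator_eq_self.2]
    intro j hj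
    by_contra hj'
    exact hj (by simp only [hb j hj', smul_zero])
  have rhs : ∑ᶠ i, (c.χ i : ℤ) • a i = ∑ᶠ i ∈ T, (c.χ i : ℤ) • a i := by
    rw [finsum_mem_def, Set.indicator_eq_self.2]
    intro i hi
    by_contra hi'
    exact hi (by simp only [ha i hi', smul_zero])
  rw [lhs, rhs, finsum_mem_eq_of_bijOn (g := fun i => -((c.χ i : ℤ) • a i)) c.prev hbij ?_]
  · simp only [finsum_neg_distrib]
  · intro j hj
    have hrel : c.Rel (c.prev j) j := hj
    have h1 : c.next (c.prev j) = j := c.next_eq' hrel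
    have h2 : (c.χ j : ℤ) = -(c.χ (c.prev j) : ℤ) := by
      conv_lhs => rw [← h1]
      rw [c.χ_next (show c.Rel (c.prev j) (c.next (c.prev j)) by rwa [h1]), Units.val_neg]
    rw [h2, hab _ _ hrel, neg_smul]

/-! ### The boundary traces -/

variable (C : HomologicalComplex (ModuleCat.{v} K) c) (φ : C ⟶ C)

/-- `im d(i, j)` is stable under `φⱼ`. [cite: HatcherAT2002, Thm. 2C.3 (proof)] -/
theorem mapsTo_range_d (i j : ι) : ∀ x ∈ LinearMap.range (C.d i j).hom, (φ.f j).hom x ∈ LinearMap.range (C.d i j).hom := by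
  rintro _ ⟨x, rfl⟩
  refine ⟨(φ.f i).hom x, ?_⟩
  have h := congrArg (fun ψ => ψ.hom x) (φ.comm i j)
  simpa only [ModuleCat.hom_comp, LinearMap.comp_apply] using h

/-- The boundary trace `tr(φⱼ | im d(i, j))` vanishes when `i`, `j` are not related (then `d(i, j) = 0`).
[cite: HatcherAT2002, Thm. 2C.3 (proof)] -/
theorem trace_restrict_range_d_eq_zero (i j : ι) (h : ¬c.Rel i j) :
    LinearMap.trace K _ ((φ.f j).hom.restrict (mapsTo_range_d C φ i j)) = 0 := by
  haveI : Subsingleton (LinearMap.range (C.d i j).hom) := by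
    rw [C.shape _ _ h, ModuleCat.hom_zero, LinearMap.range_zero]
    infer_instance
  rw [Subsingleton.elim ((φ.f j).hom.restrict (mapsTo_range_d C φ i j)) 0, map_zero]

/-- **Degreewise trace bookkeeping**: `tr(φᵢ) = tr(H(φ)ᵢ) + tr(φ_{next i} | im dⁱ) + tr(φᵢ | im d^{prev i})` for `Cⁱ` finite-dimensional
(LEAF 1 on the short complex `C.sc i`). [cite: HatcherAT2002, Thm. 2C.3 (proof)] -/
theorem trace_f_eq (i : ι) [Module.Finite K (C.X i)] :
    LinearMap.trace K (C.X i) (φ.f i).hom =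
      LinearMap.trace K (C.homology i) (HomologicalComplex.homologyMap φ i).hom +
        LinearMap.trace K _ ((φ.f (c.next i)).hom.restrict (mapsTo_range_d C φ i (c.next i))) +
        LinearMap.trace K _ ((φ.f i).hom.restrict (mapsTo_range_d C φ (c.prev i) i)) :=
  haveI : Module.Finite K (C.sc i).X₂ := inferInstanceAs (Module.Finite K (C.X i))
  trace_τ₂_eq (C.sc i) ((HomologicalComplex.shortComplexFunctor _ c i).map φ)

/-- `Hⁱ(C)` is finite-dimensional when `Cⁱ` is. [cite: HatcherAT2002, Thm. 2C.3 (proof)] -/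
theorem moduleFinite_homology (i : ι) [Module.Finite K (C.X i)] : Module.Finite K (C.homology i) :=
  haveI : Module.Finite K (LinearMap.ker (C.sc i).g.hom) :=
    inferInstanceAs (Module.Finite K (LinearMap.ker (C.d i (c.next i)).hom))
  haveI : Module.Finite K (C.sc i).moduleCatLeftHomologyData.H :=
    inferInstanceAs (Module.Finite K (LinearMap.ker (C.sc i).g.hom ⧸ LinearMap.range (C.sc i).moduleCatToCycles))
  Module.Finite.equiv (C.sc i).moduleCatHomologyIso.toLinearEquiv.symm

/-! ### The Hopf trace formula -/

/-- A function vanishing off the rank support of a finitely supported complex is finitely supported.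
[cite: HatcherAT2002, Thm. 2C.3 (proof)] -/
theorem hasFiniteSupport_of_subsingleton {M : Type*} [AddCommGroup M] [∀ i, Module.Finite K (C.X i)]
    (hC : (GradedObject.finrankSupport C.X).Finite) (g : ι → M) (hg : ∀ i, Subsingleton (C.X i) → g i = 0) :
    g.HasFiniteSupport := by
  refine hC.subset fun i hi => ?_
  simp only [GradedObject.finrankSupport, Function.mem_support, ne_eq] at hi ⊢
  intro h0
  exact hi (hg i (Module.finrank_zero_iff.1 h0))

/-- **Hopf trace formula** (Hatcher Thm. 2C.3, Spanier 4.7.6): for an endomorphism `φ` of a homological complex of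
finite-dimensional vector spaces, of any shape with `EulerCharSigns` and finitely many non-zero terms,
`Σᶠ i, χ(i) • tr(φᵢ) = Σᶠ i, χ(i) • tr(H(φ)ᵢ)` in `K`. [cite: HatcherAT2002, Thm. 2C.3] [cite: Spanier1981, Ch. 4 §7 Thm. 6] -/
theorem finsum_χ_smul_trace_eq [c.EulerCharSigns] [∀ i, Module.Finite K (C.X i)]
    (hC : (GradedObject.finrankSupport C.X).Finite) :
    ∑ᶠ i, (c.χ i : ℤ) • LinearMap.trace K (C.X i) (φ.f i).hom =
      ∑ᶠ i, (c.χ i : ℤ) • LinearMap.trace K (C.homology i) (HomologicalComplex.homologyMap φ i).hom := by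
  -- the outgoing and incoming boundary traces
  have pair := finsum_χ_smul_eq_neg_of_pairing (c := c)
    (fun i => LinearMap.trace K _ ((φ.f (c.next i)).hom.restrict (mapsTo_range_d C φ i (c.next i))))
    (fun j => LinearMap.trace K _ ((φ.f j).hom.restrict (mapsTo_range_d C φ (c.prev j) j)))
    (fun j hj => trace_restrict_range_d_eq_zero C φ _ _ hj) (fun i hi => trace_restrict_range_d_eq_zero C φ _ _ hi)
    (fun i j hij => by
      have h1 : c.prev j = i := c.prev_eq' hij
      have h2 : c.next i = j := c.next_eq' hij
      subst h1
      rw [h2])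
  -- finite supports: everything vanishes where `Cⁱ = 0`
  have hH : (fun i => (c.χ i : ℤ) • LinearMap.trace K (C.homology i) (HomologicalComplex.homologyMap φ i).hom).HasFiniteSupport := by
    refine hasFiniteSupport_of_subsingleton C hC _ fun i hi => ?_
    haveI : Subsingleton (C.homology i) := by
      have h := EulerPoincare.finrank_homology_le C i
      rw [Module.finrank_zero_of_subsingleton (M := C.X i), Nat.le_zero] at h
      haveI := moduleFinite_homology C i
      exact Module.finrank_zero_iff.1 h
    rw [Subsingleton.elim (HomologicalComplex.homologyMap φ i).hom 0, map_zero, smul_zero]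
  have hA : (fun i => (c.χ i : ℤ) •
      LinearMap.trace K _ ((φ.f (c.next i)).hom.restrict (mapsTo_range_d C φ i (c.next i)))).HasFiniteSupport := by
    refine hasFiniteSupport_of_subsingleton C hC _ fun i hi => ?_
    haveI : Subsingleton (LinearMap.range (C.d i (c.next i)).hom) := by
      rw [Subsingleton.elim (C.d i (c.next i)).hom 0, LinearMap.range_zero]; infer_instance
    rw [Subsingleton.elim ((φ.f (c.next i)).hom.restrict (mapsTo_range_d C φ i (c.next i))) 0, map_zero, smul_zero]
  have hB : (fun i => (c.χ i : ℤ) •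
      LinearMap.trace K _ ((φ.f i).hom.restrict (mapsTo_range_d C φ (c.prev i) i))).HasFiniteSupport := by
    refine hasFiniteSupport_of_subsingleton C hC _ fun i hi => ?_
    haveI : Subsingleton (LinearMap.range (C.d (c.prev i) i).hom) := inferInstance
    rw [Subsingleton.elim ((φ.f i).hom.restrict (mapsTo_range_d C φ (c.prev i) i)) 0, map_zero, smul_zero]
  have key : ∀ i, (c.χ i : ℤ) • LinearMap.trace K (C.X i) (φ.f i).hom =
      (c.χ i : ℤ) • LinearMap.trace K (C.homology i) (HomologicalComplex.homologyMap φ i).hom +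
        ((c.χ i : ℤ) • LinearMap.trace K _ ((φ.f (c.next i)).hom.restrict (mapsTo_range_d C φ i (c.next i))) +
          (c.χ i : ℤ) • LinearMap.trace K _ ((φ.f i).hom.restrict (mapsTo_range_d C φ (c.prev i) i))) := by
    intro i
    rw [trace_f_eq C φ i, smul_add, smul_add, add_assoc]
  have hAB : (fun i => (c.χ i : ℤ) • LinearMap.trace K _ ((φ.f (c.next i)).hom.restrict (mapsTo_range_d C φ i (c.next i))) +
      (c.χ i : ℤ) • LinearMap.trace K _ ((φ.f i).hom.restrict (mapsTo_range_d C φ (c.prev i) i))).HasFiniteSupport :=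
    hA.add hB
  rw [finsum_congr key, finsum_add_distrib hH hAB, finsum_add_distrib hA hB, pair, add_neg_cancel, add_zero]

/-- **Hopf trace formula, `Finset` form**: if the non-zero terms of `C` have indices in `s`,
`Σ_{i ∈ s} χ(i) • tr(φᵢ) = Σ_{i ∈ s} χ(i) • tr(H(φ)ᵢ)`. [cite: HatcherAT2002, Thm. 2C.3] -/
theorem sum_χ_smul_trace_eq [c.EulerCharSigns] [∀ i, Module.Finite K (C.X i)] (s : Finset ι)
    (hC : GradedObject.finrankSupport C.X ⊆ s) :
    ∑ i ∈ s, (c.χ i : ℤ) • LinearMap.trace K (C.X i) (φ.f i).hom =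
      ∑ i ∈ s, (c.χ i : ℤ) • LinearMap.trace K (C.homology i) (HomologicalComplex.homologyMap φ i).hom := by
  have hfin : (GradedObject.finrankSupport C.X).Finite := s.finite_toSet.subset hC
  have h := finsum_χ_smul_trace_eq C φ hfin
  have hsub : ∀ (g : ι → K), (∀ i, Subsingleton (C.X i) → g i = 0) → Function.support g ⊆ s := by
    intro g hg i hi
    by_contra his
    have h0 : Module.finrank K (C.X i) = 0 := by
      by_contra hne
      exact his (hC (by simpa [GradedObject.finrankSupport] using hne))
    exact hi (hg i (Module.finrank_zero_iff.1 h0))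
  rwa [finsum_eq_sum_of_support_subset _ (hsub _ fun i hi => by
      rw [Subsingleton.elim (φ.f i).hom 0, map_zero, smul_zero]),
    finsum_eq_sum_of_support_subset _ (hsub _ fun i hi => by
      haveI : Subsingleton (C.homology i) := by
        have h := EulerPoincare.finrank_homology_le C i
        rw [Module.finrank_zero_of_subsingleton (M := C.X i), Nat.le_zero] at h
        haveI := moduleFinite_homology C i
        exact Module.finrank_zero_iff.1 h
      rw [Subsingleton.elim (HomologicalComplex.homologyMap φ i).hom 0, map_zero, smul_zero])] at h

end Literature.Algebra.Homology.HopfTrace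

/-- **Hopf trace formula for a bounded cochain complex**: if `Cⁿ = 0` outside `[a, b]` and `φ : C ⟶ C`,
`Σ_{n=a}^{b} (−1)ⁿ tr(φⁿ) = Σ_{n=a}^{b} (−1)ⁿ tr(Hⁿ(φ))`. [cite: HatcherAT2002, Thm. 2C.3] -/
theorem Literature.Algebra.Homology.CochainComplex.sum_negOnePow_smul_trace_eq {K : Type u} [Field K]
    (C : CochainComplex (ModuleCat.{v} K) ℤ) (φ : C ⟶ C) [∀ n, Module.Finite K (C.X n)] (a b : ℤ)
    (hC : ∀ n, n ∉ Finset.Icc a b → IsZero (C.X n)) :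
    ∑ n ∈ Finset.Icc a b, (n.negOnePow : ℤ) • LinearMap.trace K (C.X n) (φ.f n).hom =
      ∑ n ∈ Finset.Icc a b, (n.negOnePow : ℤ) • LinearMap.trace K (C.homology n) (HomologicalComplex.homologyMap φ n).hom := by
  have hsupp : GradedObject.finrankSupport C.X ⊆ (Finset.Icc a b : Finset ℤ) := by
    intro n hn
    by_contra hn'
    haveI := ModuleCat.subsingleton_of_isZero (hC n hn')
    exact hn Module.finrank_zero_of_subsingleton
  simpa using Literature.Algebra.Homology.HopfTrace.sum_χ_smul_trace_eq C φ (Finset.Icc a b) hsupp
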